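import Literature.AlgebraicGeometry.Kawanoue2007.CoefficientLemma
import Literature.AlgebraicGeometry.Resolution.DiffOpFrobeniusLinear
import Literature.AlgebraicGeometry.Resolution.SmoothImpliesRegular
import Literature.AlgebraicGeometry.Hironaka2017.Lib.FrobeniusPBasisEssFiniteType
import Mathlib.RingTheory.Jacobson.Ring
import HarnessLib

/-!
# Kawanoue 2007, Part I, Theorem 4.2.1.1 (2) «`ℍ ⊂ R × {1}`»: the elements of a leading generator system of a
# 𝔅-saturated idealistic filtration with `μ_ℋ(𝕀) = ∞` are concentrated at level `p⁰ = 1` — PROVED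

H. Kawanoue, *Toward resolution of singularities over a field of positive characteristic. Part I. Foundation; the
language of the idealistic filtration*, Publ. RIMS **43** (2007) 819–909 (= arXiv:math/0607009) [Kawanoue2007], Chapter 4
«§4.2. Nonsingularity principle», Theorem 4.2.1.1 and its proof §4.2.2 «Proof for assertion (2)» (chunks p0095 L21 –
p0097 L27 of the held arXiv text, `lit read paper:arxiv-math-0607009`; locators = chunk:line, re-read for this file).
Campaign `res-hironaka` (D-0089), rung LIT-6, seat res-lit-2: the discharge road of the seat's named fact
`Kawanoue2007_thm_4_2_1_1` (F-92, `NonsingularityPrinciple.lean`, whose part (1) is the sibling fact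
`Kawanoue2007_thm_4_2_1_1_generate`, discharged through the Coefficient Lemma). The discharge
`Kawanoue2007_thm_4_2_1_1_holds` itself is appended to `NonsingularityPrinciple.lean`; this file proves assertion (2).
NO named fact is introduced. Nothing of H. Hironaka's 2017 manuscript is asserted: the imported
`Hironaka2017/Lib/FrobeniusPBasis*.lean` files are kernel theorems (Kunz's `p`-basis) about a DEFINITION
(`ρ^e(R) = {g^{p^e}}`) of the manuscript's typed preliminaries, used here for Kawanoue's Proposition 1.3.1.2.

## What is printed (locators)

* Thm. 4.2.1.1 (2) (p0094; p0095 L21–L23): «We show that the elements in `ℍ` are concentrated at level `p⁰ = 1`, i.e.,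
  `ℍ ⊂ R × {1}`», for `𝕀` 𝔅-saturated, `ℋ = {h_l}` satisfying (i), (ii) of Setting 4.1.1 and (iii), `μ_ℋ(𝕀) = ∞`
  (Rem. 4.2.1.2 (4), p0095 L3: «in order to show `ℍ ⊂ R × {1}`, we need `𝕀` to be 𝔅-saturated»).
* Proof (p0096 L1 – p0097 L27): `ℍ_0 = ℍ ∩ (R × {1})`; «We will derive a contradiction assuming `ℍ_0 ≠ ℍ`. Set
  `e = min{e_l : e_l > 0}`.» **Step 1** (p0096 L5–L9): `𝕀_a = (ℋ)` for `0 < a ≤ 1` (Lemma 2.2.1.2 (1)) and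
  `(ℋ) = √(ℋ)` (ℜ-saturation). **Step 2** (p0096 L11–L43): with `𝒟 = {d ∈ Diff^{p^e−1}_R ; d((ℋ_0)) ⊂ (ℋ_0)}`,
  (∗) `𝒟((ℋ)) ⊂ (ℋ)` (𝔇-saturation: `d((ℋ ∖ ℋ_0)) ⊂ d(𝕀_{p^e}) ⊂ 𝕀_{p^e−(p^e−1)} = 𝕀_1 = (ℋ)`), (∗∗) for
  `R̄ = R/(ℋ_0)`, and «by Proposition 1.3.1.2» `(ℋ) = ((ℋ) ∩ R^{p^e}) + (ℋ_0)`. **Step 3** (p0096 L45 – p0097 L19):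
  `(ℋ) ⊂ (ℋ_0) + 𝔪^{p^e+1}` (radicality and `g^{p^e}` with `g ∈ (ℋ ∖ ℋ_0)`); choosing a regular system of parameters
  with `x_l = h_l` (`l ≤ L`) and `x_l^{p^{e_l}} ≡ h_l mod 𝔪^{p^{e_l}+1}` (`l > L`), «the leading term of `h_{L+1}`
  `= x_{L+1}^{p^e}` … is NOT in `(x_1, …, x_L) = {(ℋ_0) + 𝔪^{p^e+1}}/𝔪^{p^e+1}`, a contradiction!».
* Prop. 1.3.1.2 (= [Kawanoue2014] Prop. 1.2.8, tree `Resolution/DiffStableIdealsFrobeniusPowers.lean` for the polynomial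
  model): an ideal with `Diff^{≤p^e−1}(I) = I` is generated by `I ∩ R^{[p^e]}`; printed proof: expand
  `g = ∑_{J ∈ Δⁿ} g_J^{p^e} X^J` and extract the `g_J^{p^e}` with the `∂_{X^J}`.

## What is proved here, and how (faithfulness notes)

* `e_eq_zero_of_isRadical` / `e_eq_zero_of_isBSaturated` — **Thm. 4.2.1.1 (2)** for: `k` a perfect field of
  characteristic `p > 0` (`Fact p.Prime`, `CharP k p`), `R` a regular local ring essentially of finite type and formally
  smooth over `k` with PERFECT residue field, `𝕀` 𝔇-saturated and satisfying condition (radical) (resp. 𝔅-saturated),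
  `(h, e)` a finite weak leading generator system (`IsWeakLGS`: (i), (ii) at all levels, (iii)) with `muTilde 𝕀 h = ⊤`:
  every `e_l = 0`. `pow_level_eq_one_atPrime` — the printed setting (`R = A_𝔫`, `A` smooth of finite type over `k = k̄`
  of exponential characteristic `p`, `𝔫` maximal; `p = 1` = the characteristic-zero convention is vacuous): `p^{e_l} = 1`.
* ROUTE = the printed one, Steps 1–3, with Prop. 1.3.1.2 used THROUGH ITS PROOF and inside `R` instead of `R̄ = R/(ℋ_0)`
  (no quotient ring is formed): §1 Step 1 (`level_eq_span_of_muTilde_eq_top` via the Coefficient Lemma and Krull, as in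
  the proof of (1); `mem_span_of_pow_mem_span`); §2 the operators `∂_{x_i^{[j]}}`, `j ≤ p^e − 1`, of a truncated
  Hasse–Schmidt system along an adapted regular system of parameters `x'` with `x'_{v l} = h_l` for `e_l = 0`
  (`span_eq_maximalIdeal_of_sub_mem_sq`, Nakayama) preserve `(ℋ)` when `x_i` is not one of these (`apply_single_mem_span`
  = (∗)); their composites `compOp` are `R^{p^e}`-linear (`Resolution.IsDiffOpLE.apply_pow_char_pow_mul'`) and act on
  monomials by binomial coefficients (`compOp_monomial`); §2' the expansion `g = ∑_α g_α^{p^e} x'^α` from the Kunz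
  `p`-basis (`Hironaka2017.S02Preliminaries.span_frobeniusPower_monomials_eq_top_of_isFFinite`, F-finiteness from
  `isFFinite_of_essFiniteType`); §3 the extraction `partialCoeff_mem` (downward induction on the weight of the exponent
  off `ℋ_0`) and `pow_mem_sup_of_partialCoeff_mem`; §4 the contradiction `pow_not_mem_span_sup_pow` (Supporting Lemma 3
  for the family `(x_t)_{t ∈ V₀}` and quasi-regularity, `Resolution.map_residue_eq_zero_of_eval_mem_pow_succ`); §5 the
  assembly (`e = min{e_l > 0}`, `h_{L+1}` = an element of that level). Only condition (radical) of the ℜ-saturation is used.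
  Hypothesis beyond print: the residue field of `R` is assumed perfect (automatic in the printed setting, where it is `k`).

AI-written; AI review is weaker than expert review.

## References

* H. Kawanoue, Publ. RIMS 43 (2007) 819–909 = arXiv:math/0607009: Thm. 4.2.1.1 and §4.2.2 (chunks p0095–p0097),
  Prop. 1.3.1.2, Lemma 4.1.2.3, Lemma 4.1.4.1 (through `SupportingLemmas.lean`, `CoefficientLemma.lean`). [Kawanoue2007]
* E. Kunz, *Characterizations of regular local rings of characteristic p*, Amer. J. Math. 91 (1969) 772–784, Thm. 2.1
  (through `Hironaka2017/Lib/FrobeniusPBasisSpan.lean`). [Kunz1969]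
* A. Grothendieck, EGA IV₄ (1967), 16.11.2 (through `Resolution/HasseSystemRegularParameters.lean`). [EGAIV4]
-/

noncomputable section

namespace Literature.AlgebraicGeometry.Kawanoue2007

open IsLocalRing MvPolynomial
open Literature.AlgebraicGeometry.Resolution
open Literature.RingTheory.HilbertSamuel (gradedPiece gradedPiece.mk)
open scoped ENNReal

universe u

/-! ## §0. Two local-ring lemmas -/

section LocalLemmas

variable {S : Type*} [CommRing S] [IsLocalRing S]

/-- Krull's intersection theorem for an ideal of a Noetherian local ring, element form: `x ∈ I + 𝔪^N` for all
`N` implies `x ∈ I` (Matsumura Thm. 8.10 for `S/I`). [folklore] -/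
private theorem mem_of_forall_mem_sup_pow [IsNoetherianRing S] {I : Ideal S} {x : S}
    (hx : ∀ N : ℕ, x ∈ I ⊔ maximalIdeal S ^ N) : x ∈ I := by
  have hinf : (⨅ i : ℕ, maximalIdeal S ^ i • ⊤ : Submodule S (S ⧸ I)) = ⊥ :=
    Ideal.iInf_pow_smul_eq_bot_of_isLocalRing _ (maximalIdeal.isMaximal S).ne_top
  have hmem : Ideal.Quotient.mk I x ∈ (⨅ i : ℕ, maximalIdeal S ^ i • ⊤ : Submodule S (S ⧸ I)) := by
    rw [Submodule.mem_iInf]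
    intro N
    obtain ⟨y, hy, m, hm, hyx⟩ := Submodule.mem_sup.mp (hx N)
    have e1 : Ideal.Quotient.mk I x = m • (1 : S ⧸ I) := by
      rw [← hyx, map_add, Ideal.Quotient.eq_zero_iff_mem.mpr hy, zero_add, Algebra.smul_def, mul_one]
      rfl
    rw [e1]
    exact Submodule.smul_mem_smul hm Submodule.mem_top
  rw [hinf, Submodule.mem_bot, Ideal.Quotient.eq_zero_iff_mem] at hmem
  exact hmem

/-- **Generators of `𝔪` may be changed modulo `𝔪²`** (Nakayama): if `(x) = 𝔪` and `x'_i ≡ x_i mod 𝔪²` then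
`(x') = 𝔪` (used for «Choose a regular system of parameters `(x_1, …, x_d)` so that `x_l = h_l` for `1 ≤ l ≤ L`»,
p0097 L1–L3). [cite: Kawanoue2007, Thm. 4.2.1.1 (proof of (2), Step 3, chunk p0097 L1–L3)] -/
theorem span_eq_maximalIdeal_of_sub_mem_sq [IsNoetherianRing S] {ι : Type*} {x x' : ι → S}
    (hx : Ideal.span (Set.range x) = maximalIdeal S) (hsub : ∀ i, x' i - x i ∈ maximalIdeal S ^ 2) :
    Ideal.span (Set.range x') = maximalIdeal S := by
  have h2 : maximalIdeal S ^ 2 ≤ maximalIdeal S := Ideal.pow_le_self two_ne_zero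
  refine le_antisymm ?_ ?_
  · rw [Ideal.span_le]
    rintro _ ⟨i, rfl⟩
    have : x' i = x i + (x' i - x i) := by ring
    rw [this]
    exact add_mem (hx ▸ Ideal.subset_span ⟨i, rfl⟩) (h2 (hsub i))
  · -- Nakayama: `𝔪 ≤ (x') + 𝔪·𝔪`
    refine Submodule.le_of_le_smul_of_le_jacobson_bot (IsNoetherian.noetherian _)
      (IsLocalRing.jacobson_eq_maximalIdeal (⊥ : Ideal S) bot_ne_top).ge ?_
    rw [← hx, Ideal.span_le]
    rintro _ ⟨i, rfl⟩
    have : x i = x' i - (x' i - x i) := by ring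
    rw [this]
    refine sub_mem (Ideal.mem_sup_left (Ideal.subset_span ⟨i, rfl⟩)) (Ideal.mem_sup_right ?_)
    rw [Ideal.smul_eq_mul, hx, ← sq]
    exact hsub i

end LocalLemmas

/-! ## §1. Step 1: `𝕀_a = (ℋ)` for `0 < a ≤ 1`, and `(ℋ) = √(ℋ)` (p0096 L5–L9) -/

section StepOne

variable {k : Type*} [Field k] [PerfectField k] {R : Type u} [CommRing R] [IsRegularLocalRing R] [Algebra k R]
  [Algebra.EssFiniteType k R] [Algebra.FormallySmooth k R]
variable (p : ℕ) [ExpChar R p] {ι : Type*} [Fintype ι] (h : ι → R) (e : ι → ℕ) (𝕀 : IdealisticFiltration R)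

/-- `H^B ∈ (ℋ)` for `B ≠ 0`. [cite: Kawanoue2007, Thm. 4.2.1.1 (proof of (1), chunk p0095 L13: «`∑_{|[B]| ≥ a} R H^B`»)] -/
theorem hPow_mem_span_of_ne_zero {S : Type*} [CommRing S] {ι : Type*} [Fintype ι] (h : ι → S) {B : ι →₀ ℕ}
    (hB : B ≠ 0) : hPow h B ∈ Ideal.span (Set.range h) := by
  classical
  obtain ⟨l, hl⟩ := Finsupp.ne_iff.mp hB
  have hl' : B l ≠ 0 := by simpa using hl
  rw [hPow, ← Finset.mul_prod_erase Finset.univ (fun l => h l ^ B l) (Finset.mem_univ l)]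
  have hmem : h l ∈ Ideal.span (Set.range h) := Ideal.subset_span ⟨l, rfl⟩
  exact Ideal.mul_mem_right _ _ (Ideal.pow_mem_of_mem _ hmem _ (Nat.pos_of_ne_zero hl'))

/-- **Step 1, first half** [p0095 L11–L17 and p0096 L5–L7: «`𝕀_a ⊂ ∑_{|[B]| ≥ a} R H^B + 𝔪^{⌈μ(a−⌈a⌉+1)⌉}` … by Krull's
intersection theorem … `𝕀_a = ∑ R h_l = (ℋ)` for `0 < a ≤ 1`»]: for a 𝔇-saturated `𝕀`, a weak leading generator system
`(h, e)` with `μ_ℋ(𝕀) = ∞`, and every `a > 0`: `𝕀_a ⊆ (ℋ)` (Coefficient Lemma with `μ = N/a`, then Krull).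
[cite: Kawanoue2007, Thm. 4.2.1.1 (proof of (1) and Step 1 of (2), chunks p0095 L11–L17, p0096 L5–L7)] -/
theorem level_le_span_of_muTilde_eq_top (hD : 𝕀.IsDSaturated k) (H : IsWeakLGS p 𝕀 h e)
    (hμ : muTilde 𝕀 h = ⊤) {a : ℝ} (ha : 0 < a) : 𝕀.level a ≤ Ideal.span (Set.range h) := by
  intro f hf
  refine mem_of_forall_mem_sup_pow fun N => ?_
  have hμ0 : 0 ≤ (N : ℝ) / a := div_nonneg (Nat.cast_nonneg N) ha.le
  have hμlt : ENNReal.ofReal ((N : ℝ) / a) < muTilde 𝕀 h := by rw [hμ]; exact ENNReal.ofReal_lt_top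
  rw [coefficientLemma (k := k) p h e 𝕀 hD H hμ0 hμlt a] at hf
  refine (show qIdeal p h e 𝕀 ((N : ℝ) / a) a ≤ Ideal.span (Set.range h) ⊔ maximalIdeal R ^ N from
    iSup_le fun B => ?_) hf
  by_cases hB : B = 0
  · subst hB
    simp only [bracketDeg_zero, Nat.cast_zero, sub_zero, hPow_zero, Ideal.span_singleton_one, Ideal.mul_top]
    refine (levelCut_le_pow 𝕀 _ a).trans ?_
    rw [div_mul_cancel₀ _ ha.ne', Nat.ceil_natCast]
    exact le_sup_right
  · exact Ideal.mul_le_left.trans ((Ideal.span_singleton_le_iff_mem _).mpr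
      (Ideal.mem_sup_left (hPow_mem_span_of_ne_zero h hB)))

/-- **Step 1**: `𝕀_a = (ℋ)` for `0 < a ≤ 1` [p0096 L5–L7]. [cite: Kawanoue2007, Thm. 4.2.1.1 (proof of (2), Step 1, chunk p0096 L5–L7)] -/
theorem level_eq_span_of_muTilde_eq_top (hD : 𝕀.IsDSaturated k) (H : IsWeakLGS p 𝕀 h e)
    (hμ : muTilde 𝕀 h = ⊤) {a : ℝ} (ha : 0 < a) (ha1 : a ≤ 1) : 𝕀.level a = Ideal.span (Set.range h) := by
  refine le_antisymm (level_le_span_of_muTilde_eq_top (k := k) p h e 𝕀 hD H hμ ha) ?_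
  rw [Ideal.span_le]
  rintro _ ⟨l, rfl⟩
  refine 𝕀.mem_of_le ?_ (H.level_mem l)
  exact ha1.trans (by exact_mod_cast Nat.one_le_pow _ _ (expChar_pos R p))

/-- **Step 1, second half**: `(ℋ) = √(ℋ)` [p0096 L9: «Suppose `g ∈ √(ℋ)`, i.e., `gⁿ ∈ (ℋ) = 𝕀_1` … Since `𝕀` is
ℜ-saturated, this implies `g ∈ 𝕀_{1/n} = (ℋ)`»] — only condition (radical) of the ℜ-saturation is used.
[cite: Kawanoue2007, Thm. 4.2.1.1 (proof of (2), Step 1, chunk p0096 L9)] -/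
theorem mem_span_of_pow_mem_span (hD : 𝕀.IsDSaturated k) (hR : 𝕀.IsRadical) (H : IsWeakLGS p 𝕀 h e)
    (hμ : muTilde 𝕀 h = ⊤) {g : R} {n : ℕ} (hn : 0 < n) (hg : g ^ n ∈ Ideal.span (Set.range h)) :
    g ∈ Ideal.span (Set.range h) := by
  have hn0 : (0 : ℝ) < n := by exact_mod_cast hn
  have h1 : g ^ n ∈ 𝕀.level ((n : ℝ) * (1 / n)) := by
    rw [mul_one_div_cancel hn0.ne', level_eq_span_of_muTilde_eq_top (k := k) p h e 𝕀 hD H hμ one_pos le_rfl]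
    exact hg
  have h2 := hR g (1 / n) n hn h1
  rwa [level_eq_span_of_muTilde_eq_top (k := k) p h e 𝕀 hD H hμ (by positivity)
    ((div_le_one hn0).mpr (by exact_mod_cast hn))] at h2

end StepOne

/-! ## §2. Step 2: the Hasse–Schmidt operators `∂_{x_i^{[j]}}`, `j < p^e`, off the variables of `ℋ_0` preserve `(ℋ)`
(p0096 L11–L26: «`𝒟 = {d ∈ Diff^{p^e−1}_R ; d((ℋ_0)) ⊂ (ℋ_0)}` … (∗) `𝒟((ℋ)) ⊂ (ℋ)`») -/

section Operators

variable {k : Type*} [Field k] {R : Type u} [CommRing R] [Algebra k R]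
variable {d : ℕ} (x : Fin d → R) (Δ : (Fin d →₀ ℕ) → (R →ₗ[k] R)) {n : ℕ}

/-- The product of binomial coefficients in the value `∂_{x_i^{[j]}}(x^β) = C(β_i, j) x^{β − j e_i}`.
[cite: Kawanoue2007, Lemma 1.2.1.3 (1); Thm. 4.2.1.1 (proof of (2), Step 2)] -/
theorem prod_support_single_choose (β : Fin d →₀ ℕ) (i : Fin d) (j : ℕ) :
    ∏ s ∈ (Finsupp.single i j).support, (β s).choose (Finsupp.single i j s) = (β i).choose j := by
  classical
  by_cases hj : j = 0
  · subst hj; simp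
  · rw [Finsupp.support_single _ hj, Finset.prod_singleton, Finsupp.single_eq_same]

/-- `∂_{x_i^{[j]}}(x_t) = 0` for `t ≠ i`, `j ≥ 1` (so the operators in the variables off `ℋ_0 = {x_t}` kill `ℋ_0`:
«`d((ℋ_0)) ⊂ (ℋ_0)`», p0096 L13). [cite: Kawanoue2007, Thm. 4.2.1.1 (proof of (2), Step 2, chunk p0096 L13)] -/
theorem apply_single_X_eq_zero
    (hval : ∀ q β : Fin d →₀ ℕ, q.degree ≤ n → Δ q (∏ i, x i ^ β i) =
      ((∏ i ∈ q.support, (β i).choose (q i) : ℕ) : R) * ∏ i, x i ^ (β - q) i)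
    {i t : Fin d} (hti : t ≠ i) {j : ℕ} (hj : j ≠ 0) (hjn : j ≤ n) :
    Δ (Finsupp.single i j) (x t) = 0 := by
  classical
  have e1 : x t = ∏ s, x s ^ (Finsupp.single t 1) s := by
    rw [Finset.prod_eq_single t]
    · simp
    · intro s _ hs; rw [Finsupp.single_apply, if_neg (Ne.symm hs), pow_zero]
    · intro ht; exact absurd (Finset.mem_univ t) ht
  have hdeg : (Finsupp.single i j).degree ≤ n := by rwa [Finsupp.degree_single]
  rw [e1, hval _ _ hdeg, prod_support_single_choose, Finsupp.single_apply, if_neg hti,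
    Nat.choose_eq_zero_of_lt (Nat.pos_of_ne_zero hj)]
  simp

/-- In `antidiagonal (j e_i)` both components are multiples of `e_i`.
[cite: Kawanoue2007, Lemma 1.2.1.2 (generalized product rule)] -/
theorem eq_single_of_mem_antidiagonal_single {i : Fin d} {j : ℕ} {pp : (Fin d →₀ ℕ) × (Fin d →₀ ℕ)}
    (hpp : pp ∈ Finset.antidiagonal (Finsupp.single i j)) :
    pp.2 = Finsupp.single i (pp.2 i) ∧ pp.2 i ≤ j := by
  classical
  rw [Finset.mem_antidiagonal] at hpp
  refine ⟨?_, ?_⟩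
  · ext t
    by_cases ht : t = i
    · subst ht; rw [Finsupp.single_eq_same]
    · have := DFunLike.congr_fun hpp t
      rw [Finsupp.add_apply, Finsupp.single_apply, if_neg (Ne.symm ht)] at this
      rw [Finsupp.single_apply, if_neg (Ne.symm ht)]
      omega
  · have := DFunLike.congr_fun hpp i
    rw [Finsupp.add_apply, Finsupp.single_eq_same] at this
    omega

/-- **(∗) `𝒟((ℋ)) ⊂ (ℋ)`** [p0096 L17–L26]: for a 𝔇-saturated `𝕀` with `𝕀_1 = (ℋ)`, a family `(h_l, p^{e_l}) ∈ 𝕀`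
whose positive levels are `≥ e`, a system of generators `x` of `𝔪` with `x_{v l} = h_l` whenever `e_l = 0`, and a
Hasse–Schmidt system `Δ` along `x` of level `n = p^e − 1`: every `∂_{x_i^{[j]}}`, `j ≤ p^e − 1`, in a variable `x_i` NOT
among the `h_l` of level `p⁰` maps `(ℋ)` into `(ℋ)` («`d((ℋ ∖ ℋ_0)) ⊂ d(𝕀_{p^e}) ⊂ 𝕀_{p^e−(p^e−1)} = 𝕀_1 = (ℋ)`» and
`d(ℋ_0) = 0`, then the generalized product rule).
[cite: Kawanoue2007, Thm. 4.2.1.1 (proof of (2), Step 2 (∗), chunk p0096 L13–L26)] -/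
theorem apply_single_mem_span (𝕀 : IdealisticFiltration R) (hD : 𝕀.IsDSaturated k) {ι : Type*} (h : ι → R)
    (e : ι → ℕ) (p E : ℕ) (hp : 0 < p) (hlev : ∀ l, h l ∈ 𝕀.level ((p ^ e l : ℕ) : ℝ))
    (hE : ∀ l, e l = 0 ∨ E ≤ e l) (hI : 𝕀.level 1 = Ideal.span (Set.range h))
    (v : ι → Fin d) (hxv : ∀ l, e l = 0 → x (v l) = h l)
    (h0 : ∀ b, Δ 0 b = b)
    (hmul : ∀ q : Fin d →₀ ℕ, q.degree ≤ n → ∀ f g : R,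
      Δ q (f * g) = ∑ pp ∈ Finset.antidiagonal q, Δ pp.1 f * Δ pp.2 g)
    (hval : ∀ q β : Fin d →₀ ℕ, q.degree ≤ n → Δ q (∏ i, x i ^ β i) =
      ((∏ i ∈ q.support, (β i).choose (q i) : ℕ) : R) * ∏ i, x i ^ (β - q) i)
    (hdiff : ∀ q : Fin d →₀ ℕ, q.degree ≤ n → IsDiffOpLE k q.degree (Δ q))
    (hn : n + 1 = p ^ E) {i : Fin d} (hi : ∀ l, e l = 0 → v l ≠ i) :
    ∀ f ∈ Ideal.span (Set.range h), ∀ j ≤ n, Δ (Finsupp.single i j) f ∈ Ideal.span (Set.range h) := by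
  classical
  intro f hf
  induction hf using Submodule.span_induction with
  | mem f hf =>
    obtain ⟨l, rfl⟩ := hf
    intro j hj
    by_cases hj0 : j = 0
    · subst hj0; rw [Finsupp.single_zero, h0]; exact Ideal.subset_span ⟨l, rfl⟩
    rcases hE l with hl | hl
    · rw [← hxv l hl, apply_single_X_eq_zero x Δ hval (hi l hl) hj0 hj]
      exact Ideal.zero_mem _
    · -- 𝔇-saturation: `d(h_l) ∈ 𝕀_{p^{e_l} − j} ⊂ 𝕀_1 = (ℋ)`
      have hdj : IsDiffOpLE k j (Δ (Finsupp.single i j)) := by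
        have := hdiff (Finsupp.single i j) (by rwa [Finsupp.degree_single])
        rwa [Finsupp.degree_single] at this
      have h1 := (IdealisticFiltration.isDSaturated_iff k 𝕀).mp hD j _ hdj _ _ (hlev l)
      rw [← hI]
      refine 𝕀.mem_of_le ?_ h1
      have h2 : p ^ E ≤ p ^ e l := Nat.pow_le_pow_right hp hl
      have h3 : (j : ℝ) + 1 ≤ ((p ^ e l : ℕ) : ℝ) := by exact_mod_cast (show j + 1 ≤ p ^ e l by omega)
      linarith
  | zero => intro j _; rw [map_zero]; exact Ideal.zero_mem _
  | add f g _ _ hf hg => intro j hj; rw [map_add]; exact Ideal.add_mem _ (hf j hj) (hg j hj)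
  | smul r f _ hf =>
    intro j hj
    rw [smul_eq_mul, hmul _ (by rwa [Finsupp.degree_single])]
    refine Ideal.sum_mem _ fun pp hpp => ?_
    obtain ⟨hpp2, hle⟩ := eq_single_of_mem_antidiagonal_single hpp
    rw [hpp2]
    exact Ideal.mul_mem_left _ _ (hf _ (hle.trans hj))

/-- The composite `∂_{x_{i_1}^{[γ_{i_1}]}} ∘ ⋯ ∘ ∂_{x_{i_m}^{[γ_{i_m}]}}` along a list of variables (the operator `D` of
the proof of Prop. 1.3.1.2 = [Kawanoue2014] Prop. 1.2.8, «a composition of the operators in `Diff^{≤p^e−1}`»).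
[cite: Kawanoue2007, Prop. 1.3.1.2 (proof); Thm. 4.2.1.1 (proof of (2), Step 2)] -/
def compOp (γ : Fin d →₀ ℕ) : List (Fin d) → (R →ₗ[k] R)
  | [] => LinearMap.id
  | i :: l => Δ (Finsupp.single i (γ i)) ∘ₗ compOp γ l

/-- Unfolding on `i :: l`. [cite: Kawanoue2007, Prop. 1.3.1.2 (proof)] -/
@[simp] theorem compOp_cons (γ : Fin d →₀ ℕ) (i : Fin d) (l : List (Fin d)) (f : R) :
    compOp Δ γ (i :: l) f = Δ (Finsupp.single i (γ i)) (compOp Δ γ l f) := rfl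

/-- Unfolding on `[]`. [cite: Kawanoue2007, Prop. 1.3.1.2 (proof)] -/
@[simp] theorem compOp_nil (γ : Fin d →₀ ℕ) (f : R) : compOp Δ γ [] f = f := rfl

/-- An ideal stable under the factors is stable under the composite. [cite: Kawanoue2007, Prop. 1.3.1.2 (proof)] -/
theorem compOp_mem {I : Ideal R} (γ : Fin d →₀ ℕ) (l : List (Fin d))
    (hfac : ∀ i ∈ l, ∀ f ∈ I, Δ (Finsupp.single i (γ i)) f ∈ I) : ∀ f ∈ I, compOp Δ γ l f ∈ I := by
  induction l with
  | nil => intro f hf; simpa using hf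
  | cons i l ih =>
    intro f hf
    rw [compOp_cons]
    exact hfac i (by simp) _ (ih (fun i' hi' => hfac i' (by simp [hi'])) f hf)

/-- The composite is linear over the `p^e`-th powers when its factors are. [cite: Kawanoue2007, Lemma 1.2.1.3 (2); Prop. 1.3.1.2 (proof)] -/
theorem compOp_pow_mul (q : ℕ) (γ : Fin d →₀ ℕ) (l : List (Fin d))
    (hfac : ∀ i ∈ l, ∀ c f : R, Δ (Finsupp.single i (γ i)) (c ^ q * f) = c ^ q * Δ (Finsupp.single i (γ i)) f)
    (c f : R) : compOp Δ γ l (c ^ q * f) = c ^ q * compOp Δ γ l f := by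
  induction l with
  | nil => simp
  | cons i l ih =>
    rw [compOp_cons, compOp_cons, ih (fun i' hi' => hfac i' (by simp [hi'])), hfac i (by simp)]

/-- **Values of the composite on monomials**: along a duplicate-free list `l`,
`(∏_{i ∈ l} ∂_{x_i^{[γ_i]}})(x^β) = (∏_{i ∈ l} C(β_i, γ_i)) · x^{β − γ|_l}` («`∂_J X^{[B]} = C([B], J) X^{[B] − J}`»).
[cite: Kawanoue2007, Lemma 1.2.1.3 (1); Prop. 1.3.1.2 (proof)] -/
theorem compOp_monomial
    (hval : ∀ q β : Fin d →₀ ℕ, q.degree ≤ n → Δ q (∏ i, x i ^ β i) =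
      ((∏ i ∈ q.support, (β i).choose (q i) : ℕ) : R) * ∏ i, x i ^ (β - q) i)
    (γ : Fin d →₀ ℕ) (hγ : ∀ i, γ i ≤ n) :
    ∀ l : List (Fin d), l.Nodup → ∀ β : Fin d →₀ ℕ,
      compOp Δ γ l (∏ t, x t ^ β t) =
        ((∏ i ∈ l.toFinset, (β i).choose (γ i) : ℕ) : R) *
          ∏ t, x t ^ (β - ∑ i ∈ l.toFinset, Finsupp.single i (γ i)) t := by
  classical
  intro l
  induction l with
  | nil => intro _ β; simp
  | cons i l ih =>
    intro hnd β
    obtain ⟨hil, hl⟩ := List.nodup_cons.mp hnd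
    have hil' : i ∉ l.toFinset := by simpa using hil
    rw [compOp_cons, ih hl β, ← nsmul_eq_mul, map_nsmul, nsmul_eq_mul,
      hval _ _ (by rw [Finsupp.degree_single]; exact hγ i), prod_support_single_choose,
      List.toFinset_cons, Finset.prod_insert hil', Finset.sum_insert hil', ← mul_assoc]
    congr 1
    · have : (β - ∑ x ∈ l.toFinset, Finsupp.single x (γ x)) i = β i := by
        rw [Finsupp.tsub_apply, Finsupp.finsetSum_apply, Finset.sum_eq_zero, Nat.sub_zero]
        intro s hs
        rw [Finsupp.single_apply, if_neg]
        rintro rfl; exact hil' hs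
      rw [this]; push_cast; ring
    · refine Finset.prod_congr rfl fun t _ => ?_
      congr 1
      rw [add_comm, ← tsub_tsub]

end Operators

/-! ## §2'. The expansion `g = ∑_{α ∈ Δ^d} g_α^{p^e} x^α` (proof of Prop. 1.3.1.2, «express it as `g = ∑ g_J^{p^e} X^J`»;
here from the Kunz `p`-basis of the tree, `Hironaka2017/Lib/FrobeniusPBasisSpan.lean`) -/

section Expansion

variable {R : Type u} [CommRing R] [IsLocalRing R] (p : ℕ) [Fact p.Prime] [CharP R p]

/-- **The expansion along the `p`-basis**: in a local ring `R` of characteristic `p` with perfect residue field and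
F-finite at level `e`, with `𝔪 = (x_1, …, x_d)`, every `g` is `∑_{α, α_i < p^e} g_α^{p^e} x^α` («take `g ∈ I` and
express it as `g = ∑_{J ∈ Δⁿ} g_J^{p^e} X^J`, where `Δ = {0, …, p^e − 1}`», [Kawanoue2014] Prop. 1.2.8 proof =
[Kawanoue2007] Prop. 1.3.1.2). [cite: Kawanoue2007, Prop. 1.3.1.2 (proof)] -/
theorem exists_eq_sum_pow_mul_monomial [PerfectField (ResidueField R)] {e : ℕ}
    (hF : Resolution.IsFFinite p e R) {d : ℕ} (x : Fin d → R)
    (hx : Ideal.span (Set.range x) = maximalIdeal R) (g : R) :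
    ∃ b : (Fin d → Fin (p ^ e)) → R, g = ∑ α, b α ^ p ^ e * ∏ t, x t ^ (α t : ℕ) := by
  classical
  have htop := Hironaka2017.S02Preliminaries.span_frobeniusPower_monomials_eq_top_of_isFFinite x hx hF
  have hg : g ∈ Submodule.span (Hironaka2017.S02Preliminaries.frobeniusPowerSubring R p e)
      (Set.range fun α : Fin d → Fin (p ^ e) => ∏ i, x i ^ (α i : ℕ)) := by
    rw [htop]; exact Submodule.mem_top
  obtain ⟨c, hc⟩ := (Submodule.mem_span_range_iff_exists_fun _).mp hg
  have hb : ∀ α, ∃ b : R, b ^ p ^ e = (c α : R) := fun α =>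
    Hironaka2017.S02Preliminaries.mem_frobeniusPowerSubring_iff.mp (c α).2
  choose b hb using hb
  refine ⟨b, ?_⟩
  rw [← hc]
  refine Finset.sum_congr rfl fun α _ => ?_
  rw [hb α, Subring.smul_def, smul_eq_mul]

end Expansion

/-! ## §3. Steps 2–3: extraction of the coefficients `g_α^{p^e}` and `(ℋ) ⊂ (ℋ_0) + 𝔪^{p^e+1}` (p0096 L28 – p0096 L55) -/

section Extraction

variable {k : Type*} [Field k] {R : Type u} [CommRing R] [Algebra k R]
variable {d : ℕ} (x : Fin d → R) (Δ : (Fin d →₀ ℕ) → (R →ₗ[k] R)) {q : ℕ} [NeZero q]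
variable (V₀ : Finset (Fin d))

/-- The exponent `α|_W`: zero on the coordinates `V₀` of `ℋ_0`, `α` elsewhere.
[cite: Kawanoue2007, Thm. 4.2.1.1 (proof of (2), Step 2: `R̄ = R/(ℋ_0)`)] -/
def resExp (α : Fin d → Fin q) : Fin d → Fin q := fun t => if t ∈ V₀ then 0 else α t

/-- `α|_W` on `V₀`. [cite: Kawanoue2007, Thm. 4.2.1.1 (proof of (2), Step 2)] -/
theorem resExp_of_mem {α : Fin d → Fin q} {t : Fin d} (ht : t ∈ V₀) : resExp V₀ α t = 0 := by
  simp [resExp, ht]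

/-- `α|_W` off `V₀`. [cite: Kawanoue2007, Thm. 4.2.1.1 (proof of (2), Step 2)] -/
theorem resExp_of_not_mem {α : Fin d → Fin q} {t : Fin d} (ht : t ∉ V₀) : resExp V₀ α t = α t := by
  simp [resExp, ht]

/-- `(α|_W)|_W = α|_W`. [cite: Kawanoue2007, Thm. 4.2.1.1 (proof of (2), Step 2)] -/
theorem resExp_resExp (α : Fin d → Fin q) : resExp V₀ (resExp V₀ α) = resExp V₀ α := by
  ext t; by_cases ht : t ∈ V₀ <;> simp [resExp, ht]

/-- The partial coefficient `G_δ = ∑_{α : α|_W = δ} g_α^{q} x^{α|_{V₀}}` (an element of `R^{[q]}[ℋ_0]`; in `R̄ = R/(ℋ_0)`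
it is the coefficient `ḡ_δ^{q}` of the proof of Prop. 1.3.1.2). [cite: Kawanoue2007, Thm. 4.2.1.1 (proof of (2), Step 2); Prop. 1.3.1.2 (proof)] -/
def partialCoeff (b : (Fin d → Fin q) → R) (δ : Fin d → Fin q) : R :=
  ∑ α ∈ Finset.univ.filter (fun α => resExp V₀ α = δ), b α ^ q * ∏ t ∈ V₀, x t ^ (α t : ℕ)

/-- The weight `|δ|`. [cite: Kawanoue2007, Prop. 1.3.1.2 (proof)] -/
def expWeight (δ : Fin d → Fin q) : ℕ := ∑ t, (δ t : ℕ)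

omit [NeZero q] in
/-- `|δ| ≤ d q`. [cite: Kawanoue2007, Prop. 1.3.1.2 (proof)] -/
theorem expWeight_le (δ : Fin d → Fin q) : expWeight δ ≤ d * q := by
  unfold expWeight
  calc ∑ t, (δ t : ℕ) ≤ ∑ _t : Fin d, q := Finset.sum_le_sum fun t _ => (δ t).2.le
    _ = d * q := by simp

omit [NeZero q] in
/-- `δ ≤ δ'` pointwise and `δ ≠ δ'` give `|δ| < |δ'|`. [cite: Kawanoue2007, Prop. 1.3.1.2 (proof)] -/
theorem expWeight_lt_of_le_of_ne {δ δ' : Fin d → Fin q} (hle : ∀ t, (δ t : ℕ) ≤ δ' t) (hne : δ ≠ δ') :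
    expWeight δ < expWeight δ' := by
  obtain ⟨t, ht⟩ : ∃ t, δ t ≠ δ' t := by
    by_contra hcon
    exact hne (funext fun t => by
      by_contra h'; exact hcon ⟨t, h'⟩)
  have hlt : (δ t : ℕ) < δ' t := lt_of_le_of_ne (hle t) (fun h' => ht (Fin.ext h'))
  exact Finset.sum_lt_sum (fun s _ => hle s) ⟨t, Finset.mem_univ t, hlt⟩

/-- The exponent `α` as a finitely supported function. [cite: Kawanoue2007, Prop. 1.3.1.2 (proof)] -/
def toExp (α : Fin d → Fin q) : Fin d →₀ ℕ := Finsupp.equivFunOnFinite.symm fun t => (α t : ℕ)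

omit [NeZero q] in
/-- Values of `toExp`. [cite: Kawanoue2007, Prop. 1.3.1.2 (proof)] -/
@[simp] theorem toExp_apply (α : Fin d → Fin q) (t : Fin d) : toExp α t = (α t : ℕ) := by
  simp [toExp]

/-- **Extraction of the partial coefficients** [proof of Prop. 1.3.1.2 as used in Step 2, p0096 L28–L43: from
`g = ∑_α g_α^{q} x^α ∈ I` and the stability of `I` under the composites `∏_{i ∉ V₀} ∂_{x_i^{[δ_i]}}` (which are
`R^{[q]}`-linear and act on monomials by `C(α, δ) x^{α−δ}`), every partial coefficient `G_δ`, `δ|_{V₀} = 0`, lies in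
`I` — downward induction on `|δ|` (the printed «`D g ∈ I` … If `J₀ ≰ J`, then `C(J, J₀) = 0` … maximality of `J₀`»)].
[cite: Kawanoue2007, Thm. 4.2.1.1 (proof of (2), Step 2); Prop. 1.3.1.2 (proof)] -/
theorem partialCoeff_mem {I : Ideal R} (L : List (Fin d))
    (hstab : ∀ γ : Fin d →₀ ℕ, (∀ t, γ t < q) → (∀ t ∈ V₀, γ t = 0) → ∀ f ∈ I, compOp Δ γ L f ∈ I)
    (hfrob : ∀ γ : Fin d →₀ ℕ, (∀ t, γ t < q) → ∀ c f : R, compOp Δ γ L (c ^ q * f) = c ^ q * compOp Δ γ L f)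
    (hvalC : ∀ γ : Fin d →₀ ℕ, (∀ t, γ t < q) → ∀ β : Fin d →₀ ℕ,
      compOp Δ γ L (∏ t, x t ^ β t) = ((∏ i, (β i).choose (γ i) : ℕ) : R) * ∏ t, x t ^ (β - γ) t)
    (b : (Fin d → Fin q) → R) (hg : ∑ α, b α ^ q * ∏ t, x t ^ (α t : ℕ) ∈ I) :
    ∀ δ : Fin d → Fin q, resExp V₀ δ = δ → partialCoeff x V₀ b δ ∈ I := by
  classical
  -- downward induction on the weight
  suffices hmain : ∀ m : ℕ, ∀ δ : Fin d → Fin q, d * q - expWeight δ = m → resExp V₀ δ = δ →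
      partialCoeff x V₀ b δ ∈ I from fun δ hδ => hmain _ δ rfl hδ
  intro m
  induction m using Nat.strong_induction_on with
  | _ m ih =>
  intro δ hm hδ
  have hδ0 : ∀ t ∈ V₀, (δ t : ℕ) = 0 := fun t ht => by
    have := congr_fun hδ t; rw [resExp_of_mem V₀ ht] at this; rw [← this]; rfl
  -- the composite operator `C_δ`
  set γ : Fin d →₀ ℕ := toExp δ with hγ
  have hγq : ∀ t, γ t < q := fun t => by rw [hγ, toExp_apply]; exact (δ t).2
  have hγ0 : ∀ t ∈ V₀, γ t = 0 := fun t ht => by rw [hγ, toExp_apply]; exact hδ0 t ht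
  have hCg : compOp Δ γ L (∑ α, b α ^ q * ∏ t, x t ^ (α t : ℕ)) ∈ I := hstab γ hγq hγ0 _ hg
  -- its value, term by term
  have hterm : ∀ α : Fin d → Fin q, compOp Δ γ L (b α ^ q * ∏ t, x t ^ (α t : ℕ)) =
      ((∏ i, ((resExp V₀ α i : ℕ)).choose (δ i) : ℕ) : R) *
        (∏ t ∈ Finset.univ.filter (fun t => t ∉ V₀), x t ^ ((resExp V₀ α t : ℕ) - δ t)) *
        (b α ^ q * ∏ t ∈ V₀, x t ^ (α t : ℕ)) := by
    intro α
    have e1 : (∏ t, x t ^ (α t : ℕ)) = ∏ t, x t ^ (toExp α) t := by simp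
    rw [hfrob γ hγq, e1, hvalC γ hγq]
    -- binomial coefficients
    have e2 : (∏ i, ((toExp α) i).choose (γ i)) = ∏ i, ((resExp V₀ α i : ℕ)).choose (δ i) := by
      refine Finset.prod_congr rfl fun i _ => ?_
      rw [toExp_apply, hγ, toExp_apply]
      by_cases hi : i ∈ V₀
      · rw [hδ0 i hi, resExp_of_mem V₀ hi]; simp
      · rw [resExp_of_not_mem V₀ hi]
    -- monomials: split the product over `V₀` and its complement
    have e3 : (∏ t, x t ^ (toExp α - γ) t) =
        (∏ t ∈ V₀, x t ^ (α t : ℕ)) * ∏ t ∈ Finset.univ.filter (fun t => t ∉ V₀), x t ^ ((resExp V₀ α t : ℕ) - δ t) := by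
      rw [← Finset.prod_filter_mul_prod_filter_not Finset.univ (fun t => t ∈ V₀)]
      have hV : Finset.univ.filter (fun t => t ∈ V₀) = V₀ := by ext t; simp
      rw [hV]
      congr 1
      · refine Finset.prod_congr rfl fun t ht => ?_
        rw [Finsupp.tsub_apply, toExp_apply, hγ0 t ht, Nat.sub_zero]
      · refine Finset.prod_congr rfl fun t ht => ?_
        rw [Finset.mem_filter] at ht
        rw [Finsupp.tsub_apply, toExp_apply, hγ, toExp_apply, resExp_of_not_mem V₀ ht.2]
    rw [e2, e3]; ring
  -- regroup by the fibres of `resExp`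
  set S := (Finset.univ : Finset (Fin d → Fin q)).image (resExp V₀) with hS
  set F : (Fin d → Fin q) → R := fun δ' =>
    ((∏ i, ((δ' i : ℕ)).choose (δ i) : ℕ) : R) *
      (∏ t ∈ Finset.univ.filter (fun t => t ∉ V₀), x t ^ ((δ' t : ℕ) - δ t)) * partialCoeff x V₀ b δ' with hF
  have hsum : compOp Δ γ L (∑ α, b α ^ q * ∏ t, x t ^ (α t : ℕ)) = ∑ δ' ∈ S, F δ' := by
    rw [map_sum]
    simp_rw [hterm]
    rw [← Finset.sum_fiberwise_of_maps_to (s := Finset.univ) (t := S) (g := resExp V₀)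
      (fun α _ => Finset.mem_image_of_mem _ (Finset.mem_univ α))]
    refine Finset.sum_congr rfl fun δ' _ => ?_
    simp only [hF, partialCoeff, Finset.mul_sum]
    refine Finset.sum_congr rfl fun α hα => ?_
    rw [(Finset.mem_filter.mp hα).2]
  -- isolate the fibre of `δ`
  have hδS : δ ∈ S := Finset.mem_image.mpr ⟨δ, Finset.mem_univ _, hδ⟩
  rw [hsum, ← Finset.add_sum_erase S F hδS] at hCg
  have hFδ : F δ = partialCoeff x V₀ b δ := by
    have h1 : (∏ i, ((δ i : ℕ)).choose (δ i) : ℕ) = 1 := Finset.prod_eq_one fun i _ => Nat.choose_self _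
    have h2 : (∏ t ∈ Finset.univ.filter (fun t => t ∉ V₀), x t ^ ((δ t : ℕ) - δ t)) = 1 :=
      Finset.prod_eq_one fun t _ => by rw [Nat.sub_self, pow_zero]
    simp only [hF, h1, h2, Nat.cast_one, one_mul]
  have hrest : ∑ δ' ∈ S.erase δ, F δ' ∈ I := by
    refine Ideal.sum_mem _ fun δ' hδ' => ?_
    obtain ⟨hne, hδ'S⟩ := Finset.mem_erase.mp hδ'
    have hδ'res : resExp V₀ δ' = δ' := by
      obtain ⟨α, _, rfl⟩ := Finset.mem_image.mp hδ'S; exact resExp_resExp V₀ α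
    by_cases hle : ∀ t, (δ t : ℕ) ≤ δ' t
    · -- larger weight: induction hypothesis
      have hw : expWeight δ < expWeight δ' := expWeight_lt_of_le_of_ne hle (Ne.symm hne)
      have hw' := expWeight_le δ'
      have hI : partialCoeff x V₀ b δ' ∈ I := ih (d * q - expWeight δ') (by omega) δ' rfl hδ'res
      simp only [hF]; exact Ideal.mul_mem_left _ _ hI
    · -- a vanishing binomial coefficient
      push Not at hle
      obtain ⟨t, ht⟩ := hle
      have h0 : (∏ i, ((δ' i : ℕ)).choose (δ i) : ℕ) = 0 :=
        Finset.prod_eq_zero (Finset.mem_univ t) (Nat.choose_eq_zero_of_lt ht)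
      simp only [hF, h0, Nat.cast_zero, zero_mul]; exact Ideal.zero_mem _
  rw [hFδ] at hCg
  have := Ideal.sub_mem _ hCg hrest
  rwa [add_sub_cancel_right] at this

/-- From `G_δ ∈ I`: the pure coefficient `g_δ^{q} ∈ I + (x_t : t ∈ V₀)` for `δ|_{V₀} = 0` (the other members of the
fibre carry a factor `x_t`, `t ∈ V₀`). [cite: Kawanoue2007, Thm. 4.2.1.1 (proof of (2), Step 2, «`(ℋ) = ((ℋ) ∩ R^{p^e}) + (ℋ_0)`», chunk p0096 L43)] -/
theorem pow_mem_sup_of_partialCoeff_mem {I : Ideal R} (b : (Fin d → Fin q) → R) {δ : Fin d → Fin q}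
    (hδ : resExp V₀ δ = δ) (hG : partialCoeff x V₀ b δ ∈ I) :
    b δ ^ q ∈ I ⊔ Ideal.span ((fun t => x t) '' (V₀ : Set (Fin d))) := by
  classical
  have hδ0 : ∀ t ∈ V₀, (δ t : ℕ) = 0 := fun t ht => by
    have := congr_fun hδ t; rw [resExp_of_mem V₀ ht] at this; rw [← this]; rfl
  have hmem : δ ∈ Finset.univ.filter (fun α => resExp V₀ α = δ) := by simp [hδ]
  unfold partialCoeff at hG
  rw [← Finset.add_sum_erase _ _ hmem] at hG
  have h1 : (∏ t ∈ V₀, x t ^ (δ t : ℕ)) = 1 := Finset.prod_eq_one fun t ht => by rw [hδ0 t ht, pow_zero]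
  rw [h1, mul_one] at hG
  have hrest : ∑ α ∈ (Finset.univ.filter (fun α => resExp V₀ α = δ)).erase δ,
      b α ^ q * ∏ t ∈ V₀, x t ^ (α t : ℕ) ∈ Ideal.span ((fun t => x t) '' (V₀ : Set (Fin d))) := by
    refine Ideal.sum_mem _ fun α hα => Ideal.mul_mem_left _ _ ?_
    obtain ⟨hne, hα'⟩ := Finset.mem_erase.mp hα
    have hres : resExp V₀ α = δ := (Finset.mem_filter.mp hα').2
    -- `α` differs from `δ` at some `t ∈ V₀`, where `α_t ≥ 1`
    obtain ⟨t, ht⟩ : ∃ t, α t ≠ δ t := by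
      by_contra hcon
      exact hne (funext fun t => by by_contra h'; exact hcon ⟨t, h'⟩)
    have htV : t ∈ V₀ := by
      by_contra htV; rw [← hres, resExp_of_not_mem V₀ htV] at ht; exact ht rfl
    have hαt : (α t : ℕ) ≠ 0 := by
      intro h0; apply ht; rw [Fin.ext_iff, h0, hδ0 t htV]
    rw [← Finset.mul_prod_erase V₀ _ htV]
    refine Ideal.mul_mem_right _ _ (Ideal.pow_mem_of_mem _ ?_ _ (Nat.pos_of_ne_zero hαt))
    exact Ideal.subset_span ⟨t, Finset.mem_coe.mpr htV, rfl⟩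
  have := Ideal.sub_mem _ (Ideal.mem_sup_left hG) (Ideal.mem_sup_right hrest)
  rwa [add_sub_cancel_right] at this

end Extraction

/-! ## §4. Step 3, the contradiction: `x_{L+1}^{p^e} ∉ (x_1, …, x_L) + 𝔪^{p^e+1}` (p0097 L5–L19) -/

section Contradiction

variable {R : Type u} [CommRing R] [IsRegularLocalRing R]
variable {d : ℕ} (hd : (maximalIdeal R).spanFinrank = d) (x : Fin d → R)
  (hx : Ideal.span (Set.range x) = maximalIdeal R)

include hd hx in
/-- **The finishing argument** [p0097 L5–L19: «we identify `R/𝔪^{p^e+1} ≅ k[x_1,…,x_d]/(x_1,…,x_d)^{p^e+1}` … the leading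
term of `h_{L+1}` `= x_{L+1}^{p^e}` … which obviously is NOT in the middle quotient `(x_1, …, x_L)` … a contradiction!»]:
for a regular system of parameters `x` of a regular local ring, a set `V₀` of variables and `i ∉ V₀`, `n ≥ 1`:
`x_i^n ∉ (x_t : t ∈ V₀) + 𝔪^{n+1}` (Supporting Lemma 3 for the family `(x_t)_{t ∈ V₀}` retakes the coefficients in
`𝔪^{n−1}`; the resulting form of degree `n` vanishes to order `n + 1`, so by quasi-regularity all its coefficients lie
in `𝔪` — but the coefficient of `X_i^n` is `1`). [cite: Kawanoue2007, Thm. 4.2.1.1 (proof of (2), Step 3, chunk p0097 L5–L19)] -/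
theorem pow_not_mem_span_sup_pow (V₀ : Finset (Fin d)) {i : Fin d} (hi : i ∉ V₀) {n : ℕ} (hn : 1 ≤ n) :
    x i ^ n ∉ Ideal.span ((fun t => x t) '' (V₀ : Set (Fin d))) ⊔ maximalIdeal R ^ (n + 1) := by
  classical
  intro hmem
  obtain ⟨a, ha, m, hm, hsum⟩ := Submodule.mem_sup.mp hmem
  have hxm : ∀ t, x t ∈ maximalIdeal R := fun t => hx ▸ Ideal.subset_span ⟨t, rfl⟩
  have han : a ∈ maximalIdeal R ^ n := by
    have : a = x i ^ n - m := by rw [← hsum]; ring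
    rw [this]
    exact sub_mem (Ideal.pow_mem_pow (hxm i) n) (Ideal.pow_le_pow_right (Nat.le_succ n) hm)
  -- Supporting Lemma 3 for the family `(x_t)_{t ∈ V₀}` (all exponents `1`): `a = Σ γ_t x_t`, `γ_t ∈ 𝔪^{n-1}`
  have ha' : a ∈ Ideal.span ((fun t : ↥V₀ => x (t : Fin d)) '' ((Finset.univ : Finset ↥V₀) : Set ↥V₀)) := by
    rw [Finset.coe_univ, Set.image_univ]
    refine Ideal.span_mono ?_ ha
    rintro _ ⟨t, ht, rfl⟩
    exact ⟨⟨t, ht⟩, rfl⟩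
  obtain ⟨γ, hγ, hsumγ⟩ := exists_repr_of_mem_span_inter_pow hd x hx (fun t : ↥V₀ => (t : Fin d))
    (fun _ => 1) (fun t : ↥V₀ => x (t : Fin d)) Subtype.val_injective (fun t => by simp) Finset.univ n a han ha'
  have hΓ : ∀ t : ↥V₀, ∃ Γ : MvPolynomial (Fin d) R, Γ.IsHomogeneous (n - 1) ∧ MvPolynomial.eval x Γ = γ t :=
    fun t => exists_isHomogeneous_eval_eq_of_mem_pow x hx (hγ t (Finset.mem_univ t))
  choose Γ hΓh hΓe using hΓ
  -- the form `P = X_i^n − Σ_t X_t Γ_t` of degree `n` vanishes to order `n + 1` at `x`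
  set P : MvPolynomial (Fin d) R := X i ^ n - ∑ t : ↥V₀, X (t : Fin d) * Γ t with hP
  have hPhom : P.IsHomogeneous n := by
    refine (isHomogeneous_X_pow i n).sub (IsHomogeneous.sum _ _ _ fun t _ => ?_)
    have := (isHomogeneous_X R (t : Fin d)).mul (hΓh t)
    rwa [show 1 + (n - 1) = n by omega] at this
  have hPeval : MvPolynomial.eval x P ∈ maximalIdeal R ^ (n + 1) := by
    have hsum' : ∑ t : ↥V₀, x (t : Fin d) * γ t = a := by
      rw [hsumγ]; exact Finset.sum_congr rfl fun t _ => mul_comm _ _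
    have : MvPolynomial.eval x P = m := by
      simp only [hP, map_sub, map_pow, eval_X, map_sum, map_mul, hΓe]
      rw [hsum', ← hsum]; ring
    rw [this]; exact hm
  have hres := map_residue_eq_zero_of_eval_mem_pow_succ hd x hx hPhom hPeval
  have hcoeff : MvPolynomial.coeff (Finsupp.single i n) P = 1 := by
    rw [hP, coeff_sub, coeff_X_pow, if_pos rfl, coeff_sum, Finset.sum_eq_zero, sub_zero]
    intro t _
    rw [coeff_X_mul', if_neg]
    rw [Finsupp.support_single _ (by omega : n ≠ 0), Finset.mem_singleton]
    intro h'
    exact hi (h' ▸ t.2)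
  have := congrArg (MvPolynomial.coeff (Finsupp.single i n)) hres
  rw [coeff_map, hcoeff, map_one, coeff_zero] at this
  exact one_ne_zero this

end Contradiction

/-! ## §5. Theorem 4.2.1.1 (2) for a regular local ring essentially of finite type and formally smooth over a perfect
field, with perfect residue field -/

section Main

variable {k : Type*} [Field k] [PerfectField k] {R : Type u} [CommRing R] [IsRegularLocalRing R] [Algebra k R]
  [Algebra.EssFiniteType k R] [Algebra.FormallySmooth k R]
variable (p : ℕ) [Fact p.Prime] [CharP k p] [ExpChar R p] [PerfectField (ResidueField R)]
variable {ι : Type*} [Fintype ι] (h : ι → R) (e : ι → ℕ) (𝕀 : IdealisticFiltration R)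

/-- **Kawanoue 2007, Theorem 4.2.1.1 (2) «`ℍ ⊂ R × {1}`» — PROVED** [statement chunk p0094; proof p0095 L21 – p0097 L27:
«We will derive a contradiction assuming `ℍ_0 ≠ ℍ`. Set `e = min{e_l : e_l > 0}` … Step 1 (`𝕀_a = (ℋ)` for
`0 < a ≤ 1`, `(ℋ) = √(ℋ)`), Step 2 (`(ℋ) = ((ℋ) ∩ R^{p^e}) + (ℋ_0)` via (∗), (∗∗) and Prop. 1.3.1.2), Step 3
(`(ℋ) ⊂ (ℋ_0) + 𝔪^{p^e+1}` against the leading term `x_{L+1}^{p^e}` of `h_{L+1}`)»], for: `k` a perfect field of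
characteristic `p > 0`, `R` a regular local ring essentially of finite type and formally smooth over `k` with perfect
residue field, `𝕀` 𝔇-saturated and radically closed (conditions (differential) and (radical) of the 𝔅-saturation — the
continuity half of the ℜ-saturation is not used), `(h, e)` a weak leading generator system with `μ_ℋ(𝕀) = ∞`: every
`e_l = 0`. Route = the printed one; Prop. 1.3.1.2 is used through its proof (expansion along the Kunz `p`-basis,
`Hironaka2017/Lib/FrobeniusPBasisSpan.lean`, and extraction by the composites of the `∂_{x_i^{[j]}}`, `j < p^e`, in
the variables off `ℋ_0`, which are `R^{p^e}`-linear, `Resolution/DiffOpFrobeniusLinear.lean`) inside `R` rather than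
in `R̄ = R/(ℋ_0)`. The printed `R` (localization at a closed point of a variety smooth over `k = k̄`) is an instance
(`pow_level_eq_one_atPrime`). -- TODO(general form): `R` = completion; characteristic zero (`p = ∞`) is vacuous.
[cite: Kawanoue2007, Thm. 4.2.1.1 (2)] -/
theorem e_eq_zero_of_isRadical (hD : 𝕀.IsDSaturated k) (hR : 𝕀.IsRadical) (H : IsWeakLGS p 𝕀 h e)
    (hμ : muTilde 𝕀 h = ⊤) (l : ι) : e l = 0 := by
  classical
  have hp : p.Prime := Fact.out
  have hp0 : 0 < p := hp.pos
  haveI : CharP R p := charP_of_injective_algebraMap (algebraMap k R).injective p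
  by_contra hl0
  -- the minimal positive level `E` and an element `h_{l₁}` of that level
  set T : Finset ℕ := (Finset.univ.filter fun l => e l ≠ 0).image e with hT
  have hlT : e l ∈ T := Finset.mem_image.mpr ⟨l, Finset.mem_filter.mpr ⟨Finset.mem_univ l, hl0⟩, rfl⟩
  have hTne : T.Nonempty := ⟨e l, hlT⟩
  obtain ⟨l₁, hl₁, hl₁E⟩ := Finset.mem_image.mp (Finset.min'_mem T hTne)
  set E := T.min' hTne with hEdef
  have he₁ : e l₁ ≠ 0 := (Finset.mem_filter.mp hl₁).2
  have hEpos : 0 < E := by rw [← hl₁E]; exact Nat.pos_of_ne_zero he₁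
  have hE : ∀ l, e l = 0 ∨ E ≤ e l := fun l => by
    by_cases hl : e l = 0
    · exact Or.inl hl
    · exact Or.inr (Finset.min'_le T (e l)
        (Finset.mem_image.mpr ⟨l, Finset.mem_filter.mpr ⟨Finset.mem_univ l, hl⟩, rfl⟩))
  have hq1 : 1 ≤ p ^ E := Nat.one_le_pow _ _ hp0
  have hq2 : 2 ≤ p ^ E :=
    le_trans hp.two_le (by simpa using Nat.pow_le_pow_right hp0 (show 1 ≤ E from hEpos))
  haveI : NeZero (p ^ E) := ⟨by positivity⟩
  -- Step 1: `𝕀_1 = (ℋ)` and `(ℋ)` is radical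
  set I := Ideal.span (Set.range h) with hI
  have hI1 : 𝕀.level 1 = I := level_eq_span_of_muTilde_eq_top (k := k) p h e 𝕀 hD H hμ one_pos le_rfl
  have hrad : ∀ (g : R) (n : ℕ), 0 < n → g ^ n ∈ I → g ∈ I := fun g n hn hg =>
    mem_span_of_pow_mem_span (k := k) p h e 𝕀 hD hR H hμ hn hg
  -- Step 3, first half: an adapted regular system of parameters with `x_{v l} = h_l` whenever `e_l = 0`
  obtain ⟨d, x, v, hd, hx, hv, hh⟩ :=
    exists_rsop_sub_pow_mem p h e H.pow_mem (fun l => (H.pure l).2) H.linearIndependent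
  let x' : Fin d → R := fun t => if ht : ∃ l, e l = 0 ∧ v l = t then h (Classical.choose ht) else x t
  have hx'v : ∀ l, e l = 0 → x' (v l) = h l := by
    intro l hl
    have ht : ∃ l', e l' = 0 ∧ v l' = v l := ⟨l, hl, rfl⟩
    simp only [x', dif_pos ht]
    rw [hv (Classical.choose_spec ht).2]
  have hx'x : ∀ t, (¬ ∃ l, e l = 0 ∧ v l = t) → x' t = x t := fun t ht => by simp only [x', dif_neg ht]
  have hsub2 : ∀ t, x' t - x t ∈ maximalIdeal R ^ 2 := by
    intro t
    by_cases ht : ∃ l, e l = 0 ∧ v l = t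
    · obtain ⟨l, hl, rfl⟩ := ht
      rw [hx'v l hl]
      have := hh l
      rwa [hl, pow_zero, pow_one, one_add_one_eq_two] at this
    · rw [hx'x t ht, sub_self]; exact Ideal.zero_mem _
  have hx' : Ideal.span (Set.range x') = maximalIdeal R := span_eq_maximalIdeal_of_sub_mem_sq hx hsub2
  have hh' : ∀ l, e l ≠ 0 → h l - x' (v l) ^ p ^ e l ∈ maximalIdeal R ^ (p ^ e l + 1) := by
    intro l hl
    have ht : ¬ ∃ l', e l' = 0 ∧ v l' = v l := by
      rintro ⟨l', hl', hvl⟩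
      rw [hv hvl] at hl'
      exact hl hl'
    rw [hx'x _ ht]; exact hh l
  -- Step 2: the Hasse–Schmidt system of level `p^E − 1` along `x'`
  have hcard : Fintype.card (Fin d) = (maximalIdeal R).spanFinrank := by rw [Fintype.card_fin, hd]
  obtain ⟨Δ, h0, hmul, hval, hdiff⟩ :=
    Resolution.exists_hasseSystem_of_span_eq_maximalIdeal (k := k) x' hx' hcard (p ^ E - 1)
  have hn : p ^ E - 1 + 1 = p ^ E := Nat.sub_add_cancel hq1
  -- the coordinates `V₀` of `ℋ_0`
  set V₀ : Finset (Fin d) := (Finset.univ.filter fun l => e l = 0).image v with hV₀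
  have hV₀' : ∀ i, i ∉ V₀ → ∀ l, e l = 0 → v l ≠ i := fun i hi l hl hvl =>
    hi (Finset.mem_image.mpr ⟨l, Finset.mem_filter.mpr ⟨Finset.mem_univ l, hl⟩, hvl⟩)
  -- (∗): the single operators off `V₀` preserve `I`; they are `R^{p^E}`-linear
  have hstab1 : ∀ i ∉ V₀, ∀ f ∈ I, ∀ j ≤ p ^ E - 1, Δ (Finsupp.single i j) f ∈ I := fun i hi =>
    apply_single_mem_span x' Δ 𝕀 hD h e p E hp0 H.level_mem hE hI1 v hx'v h0 hmul hval
      (fun q' hq' => hdiff q'.degree q' le_rfl hq') hn (hV₀' i hi)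
  have hfrob1 : ∀ (i : Fin d) (j : ℕ), j ≤ p ^ E - 1 → ∀ c f : R,
      Δ (Finsupp.single i j) (c ^ p ^ E * f) = c ^ p ^ E * Δ (Finsupp.single i j) f := by
    intro i j hj c f
    have hdj : IsDiffOpLE k j (Δ (Finsupp.single i j)) :=
      hdiff j (Finsupp.single i j) (by rw [Finsupp.degree_single]) hj
    exact IsDiffOpLE.apply_pow_char_pow_mul' p hdj (by omega) c f
  -- the composites along all the variables
  set L := (Finset.univ : Finset (Fin d)).toList with hL
  have hLnd : L.Nodup := Finset.nodup_toList _
  have hLu : L.toFinset = Finset.univ := Finset.toList_toFinset _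
  have hstab : ∀ γ : Fin d →₀ ℕ, (∀ t, γ t < p ^ E) → (∀ t ∈ V₀, γ t = 0) →
      ∀ f ∈ I, compOp Δ γ L f ∈ I := by
    intro γ hγq hγ0
    refine compOp_mem Δ γ L fun i _ f hf => ?_
    by_cases hi : i ∈ V₀
    · rw [hγ0 i hi, Finsupp.single_zero, h0]; exact hf
    · exact hstab1 i hi f hf (γ i) (by have := hγq i; omega)
  have hfrob : ∀ γ : Fin d →₀ ℕ, (∀ t, γ t < p ^ E) → ∀ c f : R,
      compOp Δ γ L (c ^ p ^ E * f) = c ^ p ^ E * compOp Δ γ L f :=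
    fun γ hγq => compOp_pow_mul Δ (p ^ E) γ L fun i _ => hfrob1 i (γ i) (by have := hγq i; omega)
  have hvalC : ∀ γ : Fin d →₀ ℕ, (∀ t, γ t < p ^ E) → ∀ β : Fin d →₀ ℕ,
      compOp Δ γ L (∏ t, x' t ^ β t) = ((∏ i, (β i).choose (γ i) : ℕ) : R) * ∏ t, x' t ^ (β - γ) t := by
    intro γ hγq β
    rw [compOp_monomial x' Δ hval γ (fun i => by have := hγq i; omega) L hLnd β, hLu,
      Finsupp.univ_sum_single]
  -- the expansion of `h_{l₁}` along the `p`-basis, and the extraction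
  haveI : ExpChar k p := ExpChar.prime hp
  haveI : PerfectRing k p := PerfectField.toPerfectRing p
  have hF : Resolution.IsFFinite p E R := Hironaka2017.S02Preliminaries.isFFinite_of_essFiniteType (𝕂 := k) p E
  obtain ⟨b, hb⟩ := exists_eq_sum_pow_mul_monomial p hF x' hx' (h l₁)
  have hgI : ∑ α, b α ^ p ^ E * ∏ t, x' t ^ (α t : ℕ) ∈ I := hb ▸ Ideal.subset_span ⟨l₁, rfl⟩
  have hG := partialCoeff_mem x' Δ V₀ L hstab hfrob hvalC b hgI
  -- Step 3: `h_{l₁} ∈ (ℋ_0) + 𝔪^{p^E + 1}`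
  set J := Ideal.span ((fun t => x' t) '' (V₀ : Set (Fin d))) with hJ
  have hJI : J ≤ I := by
    rw [hJ, Ideal.span_le]
    rintro _ ⟨t, ht, rfl⟩
    obtain ⟨l, hl, rfl⟩ := Finset.mem_image.mp (Finset.mem_coe.mp ht)
    show x' (v l) ∈ I
    rw [hx'v l (Finset.mem_filter.mp hl).2]
    exact Ideal.subset_span ⟨l, rfl⟩
  have hterm : ∀ α : Fin d → Fin (p ^ E),
      b α ^ p ^ E * ∏ t, x' t ^ (α t : ℕ) ∈ J ⊔ maximalIdeal R ^ (p ^ E + 1) := by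
    intro α
    by_cases hα : resExp V₀ α = α
    · -- a pure exponent: `b_α^{p^E} ∈ I`, so `b_α ∈ I = (ℋ_0) + (ℋ ∖ ℋ_0) ⊂ J + 𝔪^{p^E}`
      have h1 : b α ^ p ^ E ∈ I :=
        sup_le le_rfl hJI (pow_mem_sup_of_partialCoeff_mem x' V₀ b hα (hG α hα))
      have h2 : b α ∈ I := hrad _ (p ^ E) (by omega) h1
      obtain ⟨r, hr⟩ := (Submodule.mem_span_range_iff_exists_fun R).mp h2
      have h3 : b α = (∑ l ∈ Finset.univ.filter (fun l => e l = 0), r l * h l) +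
          ∑ l ∈ Finset.univ.filter (fun l => ¬ e l = 0), r l * h l := by
        rw [← hr, ← Finset.sum_filter_add_sum_filter_not Finset.univ (fun l => e l = 0)]
        simp only [smul_eq_mul]
      have ha₁ : (∑ l ∈ Finset.univ.filter (fun l => e l = 0), r l * h l) ∈ J :=
        Ideal.sum_mem _ fun l hl => Ideal.mul_mem_left _ _ (by
          rw [← hx'v l (Finset.mem_filter.mp hl).2]
          exact Ideal.subset_span ⟨v l, Finset.mem_coe.mpr (Finset.mem_image.mpr ⟨l, hl, rfl⟩), rfl⟩)
      have hc₁ : (∑ l ∈ Finset.univ.filter (fun l => ¬ e l = 0), r l * h l) ∈ maximalIdeal R ^ p ^ E :=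
        Ideal.sum_mem _ fun l hl => Ideal.mul_mem_left _ _ (by
          have hl' : E ≤ e l := (hE l).resolve_left (Finset.mem_filter.mp hl).2
          exact Ideal.pow_le_pow_right (Nat.pow_le_pow_right hp0 hl') (H.pow_mem l))
      refine Ideal.mul_mem_right _ _ ?_
      rw [h3, add_pow_char_pow]
      refine add_mem (Ideal.mem_sup_left (Ideal.pow_mem_of_mem J ha₁ _ (by omega))) (Ideal.mem_sup_right ?_)
      have := Ideal.pow_mem_pow hc₁ (p ^ E)
      rw [← pow_mul] at this
      exact Ideal.pow_le_pow_right (by nlinarith) this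
    · -- some `t ∈ V₀` with `α_t ≥ 1`: the monomial lies in `J`
      obtain ⟨t, ht⟩ : ∃ t, resExp V₀ α t ≠ α t := by
        by_contra hcon
        exact hα (funext fun t => by by_contra h'; exact hcon ⟨t, h'⟩)
      have htV : t ∈ V₀ := by
        by_contra htV; exact ht (resExp_of_not_mem V₀ htV)
      have hαt : (α t : ℕ) ≠ 0 := by
        intro hz
        apply ht
        rw [resExp_of_mem V₀ htV]
        exact Fin.ext (by rw [Fin.val_zero, hz])
      refine Ideal.mem_sup_left (Ideal.mul_mem_left _ _ ?_)
      rw [← Finset.mul_prod_erase Finset.univ (fun t => x' t ^ (α t : ℕ)) (Finset.mem_univ t)]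
      exact Ideal.mul_mem_right _ _ (Ideal.pow_mem_of_mem J
        (Ideal.subset_span ⟨t, Finset.mem_coe.mpr htV, rfl⟩) _ (Nat.pos_of_ne_zero hαt))
  have hmem : h l₁ ∈ J ⊔ maximalIdeal R ^ (p ^ E + 1) := by
    rw [hb]; exact Ideal.sum_mem _ fun α _ => hterm α
  -- the leading term `x'_{v l₁}^{p^E}` of `h_{l₁}`
  have hxq : x' (v l₁) ^ p ^ E ∈ J ⊔ maximalIdeal R ^ (p ^ E + 1) := by
    have h1 := hh' l₁ he₁
    rw [hl₁E] at h1
    have : x' (v l₁) ^ p ^ E = h l₁ - (h l₁ - x' (v l₁) ^ p ^ E) := by ring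
    rw [this]
    exact sub_mem hmem (Ideal.mem_sup_right h1)
  have hi : v l₁ ∉ V₀ := by
    intro hmemV
    obtain ⟨l', hl', hvl⟩ := Finset.mem_image.mp hmemV
    have := (Finset.mem_filter.mp hl').2
    rw [hv hvl] at this
    exact he₁ this
  exact pow_not_mem_span_sup_pow hd x' hx' V₀ hi hq1 hxq

/-- The same from the 𝔅-saturation (Def. 2.1.5.1: 𝔇- and ℜ-saturated). [cite: Kawanoue2007, Thm. 4.2.1.1 (2)] -/
theorem e_eq_zero_of_isBSaturated (hB : 𝕀.IsBSaturated k) (H : IsWeakLGS p 𝕀 h e) (hμ : muTilde 𝕀 h = ⊤)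
    (l : ι) : e l = 0 :=
  e_eq_zero_of_isRadical (k := k) p h e 𝕀 hB.1 hB.2.1 H hμ l

end Main

/-! ## §6. The printed setting: the local ring at a closed point of a variety smooth over `k = k̄` -/

section AtPrime

/-- At a closed point of a scheme of finite type over an algebraically closed field `k` of characteristic `p`, the
residue field of the local ring is `k` (Nullstellensatz), hence perfect. [folklore] -/
private theorem perfectField_residueField_atPrime (p : ℕ) [Fact p.Prime] (k : Type u) [Field k] [IsAlgClosed k]
    [CharP k p] (A : Type u) [CommRing A] [Algebra k A] [Algebra.FiniteType k A]
    (𝔫 : Ideal A) [𝔫.IsMaximal] : PerfectField (ResidueField (Localization.AtPrime 𝔫)) := by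
  haveI : CharP (Localization.AtPrime 𝔫) p :=
    charP_of_injective_algebraMap (algebraMap k (Localization.AtPrime 𝔫)).injective p
  haveI : CharP (ResidueField (Localization.AtPrime 𝔫)) p :=
    Hironaka2017.S02Preliminaries.charP_residueField
  have hroot : ∀ c : ResidueField (Localization.AtPrime 𝔫), ∃ d', d' ^ p = c := by
    intro c
    letI : Field (A ⧸ 𝔫) := Ideal.Quotient.field 𝔫
    haveI : Module.Finite k (A ⧸ 𝔫) := finite_of_finite_type_of_isJacobsonRing k (A ⧸ 𝔫)
    haveI : Algebra.IsIntegral k (A ⧸ 𝔫) := Algebra.IsIntegral.of_finite k _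
    have hbij := IsAlgClosed.algebraMap_bijective_of_isIntegral (k := k) (K := A ⧸ 𝔫)
    let ε := IsLocalization.AtPrime.equivQuotMaximalIdeal 𝔫 (Localization.AtPrime 𝔫)
    change ∃ d' : Localization.AtPrime 𝔫 ⧸ maximalIdeal (Localization.AtPrime 𝔫), d' ^ p = c
    obtain ⟨a, ha⟩ := hbij.2 (ε.symm c)
    obtain ⟨b, hb⟩ := IsAlgClosed.exists_pow_nat_eq a (Fact.out : p.Prime).pos
    refine ⟨ε (algebraMap k (A ⧸ 𝔫) b), ?_⟩
    rw [← map_pow, ← map_pow, hb, ha, RingEquiv.apply_symm_apply]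
  haveI : PerfectRing (ResidueField (Localization.AtPrime 𝔫)) p :=
    PerfectRing.ofSurjective _ p fun c => by
      obtain ⟨d', hd'⟩ := hroot c
      exact ⟨d', by rw [frobenius_def]; exact hd'⟩
  exact PerfectRing.toPerfectField _ p

/-- **Theorem 4.2.1.1 (2) in the printed setting** [§4.1 p0085 L17 and Thm. 4.2.1.1]: `k` algebraically closed of
exponential characteristic `p`, `A` a smooth finitely generated `k`-domain, `𝔫` maximal, `R = A_𝔫`, `𝕀` a 𝔅-saturated
idealistic filtration over `R`, `(h, e)` a finite weak leading generator system with `μ_ℋ(𝕀) = ∞`: `p^{e_l} = 1` for every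
`l` (for `p = 1`, the tree's characteristic-zero convention, this is vacuous; for `p` prime it is `e_eq_zero_of_isBSaturated`,
the residue field of `R` being `k`, perfect). [cite: Kawanoue2007, Thm. 4.2.1.1 (2)] -/
theorem pow_level_eq_one_atPrime (p : ℕ) (k : Type u) [Field k] [IsAlgClosed k] [ExpChar k p]
    (A : Type u) [CommRing A] [IsDomain A] [Algebra k A] [Algebra.FiniteType k A] [Algebra.Smooth k A]
    (𝔫 : Ideal A) [𝔫.IsMaximal] (𝕀 : IdealisticFiltration (Localization.AtPrime 𝔫))
    (hB : 𝕀.IsBSaturated k) {ι : Type*} [Finite ι] {h : ι → Localization.AtPrime 𝔫} {e : ι → ℕ}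
    (H : IsWeakLGS p 𝕀 h e) (hμ : muTilde 𝕀 h = ⊤) (l : ι) : p ^ e l = 1 := by
  cases ‹ExpChar k p› with
  | zero => simp
  | prime hp =>
    haveI : Fact p.Prime := ⟨hp⟩
    haveI : IsRegularLocalRing (Localization.AtPrime 𝔫) :=
      Literature.AlgebraicGeometry.Resolution.isRegularLocalRing_of_isSmoothAt k A 𝔫
    haveI : ExpChar (Localization.AtPrime 𝔫) p :=
      expChar_of_injective_algebraMap (algebraMap k (Localization.AtPrime 𝔫)).injective p
    haveI : Algebra.EssFiniteType A (Localization.AtPrime 𝔫) :=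
      Algebra.EssFiniteType.of_isLocalization (Localization.AtPrime 𝔫) 𝔫.primeCompl
    haveI : Algebra.EssFiniteType k (Localization.AtPrime 𝔫) :=
      Algebra.EssFiniteType.comp k A (Localization.AtPrime 𝔫)
    haveI : Algebra.FormallySmooth A (Localization.AtPrime 𝔫) :=
      Algebra.FormallySmooth.of_isLocalization 𝔫.primeCompl
    haveI : Algebra.FormallySmooth k (Localization.AtPrime 𝔫) :=
      Algebra.FormallySmooth.comp k A (Localization.AtPrime 𝔫)
    haveI : PerfectField (ResidueField (Localization.AtPrime 𝔫)) := perfectField_residueField_atPrime p k A 𝔫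
    haveI : Fintype ι := Fintype.ofFinite ι
    rw [e_eq_zero_of_isBSaturated (k := k) p h e 𝕀 hB H hμ l, pow_zero]

end AtPrime

end Literature.AlgebraicGeometry.Kawanoue2007

end
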